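import Literature.NumberTheory.Automorphic.OrbitalIntegralKConjugacyClasses
import Literature.NumberTheory.Automorphic.OrbitalMeasureCanonical
import Literature.NumberTheory.Automorphic.ReductiveGroupData
import HarnessLib

/-!
# The residually-regular base case of the unit orbital integral on `GL_n`:
`O_γ(1_K) = vol(K) ∕ vol(G_γ ∩ K)` when `(G·γ) ∩ K` is a single `K`-class, `= 1` for canonical measures
(Kottwitz; Laumon, *Cohomology of Drinfeld modular varieties* I (1996), Lemma (5.3.2) ∕ §4; Rogawski
(1990), §4.9 p. 54, §4.3 p. 43)

Topic `NumberTheory/Automorphic`; namespace `Literature.NumberTheory.Automorphic`. THEOREMS ONLY (no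
definition, no instance, no named fact, no `sorry`). The ORBITAL READING of the residually-regular
base case (road letter «D-S3i»): `G = GL_n(E)` over a non-archimedean local field `E`,
`K = GL_n(𝒪_E)` (★ `glInt`), `γ ∈ K`, and the SINGLE-`K`-CLASS property of the `G`-class of `γ`
inside `K`, taken as a HYPOTHESIS BINDER

  `hK1 : ∀ γ′ ∈ glInt n E, IsConj γ γ′ → ∃ k ∈ glInt n E, k * γ * k⁻¹ = γ′`

(discharged for RESIDUALLY SEPARABLE `γ` — characteristic polynomial separable modulo `𝔭` — by the
companion letter «D-S3c» `GLnResiduallyRegularConjugacy`, not here). Under `hK1`, ★ D-S3b (s4)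
(`OrbitalIntegralKConjugacyClasses.{lintegral,orbitalIntegral}_indicator_quotientMeasure_eq_of_single_conjClass`)
gives, for `t` an inversion-invariant left Haar measure on the centraliser `G_γ`, `ν` a two-sided
Haar measure on `G` and `ν/t` the quotient measure:

* (r2) **`GLn.orbitalIntegral_indicator_glInt_eq_of_single_conjClass`**:
  `O_γ^{ν/t}(1_K) = (ν(K) ∕ t(G_γ ∩ K)).toReal` (and its `∫⁻` form);
* (r3) **`…_eq_one_of_single_conjClass`**: `= 1` at `ν(K) = 1`, `t(G_γ ∩ K) = 1`;
* (r3, canonical) the docking to ★ `OrbitalMeasureFamily.IsCanonical` (`t(compactCore G_γ) = 1`):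
  `GLn.preimage_glInt_subset_compactCore` — `G_γ ∩ K ⊆ compactCore G_γ` ALWAYS (a compact subgroup);
  equality `hcore : G_γ ∩ K = compactCore G_γ` is a HYPOTHESIS (it holds iff `G_γ ∩ K` is the maximal
  compact subgroup of the torus, e.g. when `𝒪_E[γ]` is the maximal order — residual separability;
  not proved here); under it `O_γ^{ν/t}(1_K) = ν(K).toReal` for the canonically normalised `t`
  (`…_eq_of_compactCore`) and, for a CANONICAL orbital measure family `m`,
  **`GLn.classOrbitalIntegral_indicator_glInt_eq_of_isCanonical`**:
  `classOrbitalIntegral m 1_K c = ν(K).toReal` (`= 1` at `ν(K) = 1`) at every `P`-class `c` whose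
  representative lies in `K` and satisfies `hK1`, `hcore` — the unramified∕unit-element base value
  (Kottwitz; Laumon (1996), Lemma (5.3.2); Rogawski §4.9).

## References

* G. Laumon, *Cohomology of Drinfeld Modular Varieties* I (1996), Lemma (5.3.2) p. 136, §4.3
  [Laumon1995].
* J. D. Rogawski, *Automorphic Representations of Unitary Groups in Three Variables* (1990), §4.9 p. 54,
  §4.3 p. 43 [Rogawski1990].
-/

noncomputable section

open MeasureTheory Measure Topology Set Filter Function
open Literature.MeasureTheory.Group
open scoped ENNReal NNReal MatrixGroups

namespace Literature.NumberTheory.Automorphic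

/-! ### The single-class hypothesis and the compact core -/

section Algebra

variable {E : Type*} [Field E] [ValuativeRel E] {n : ℕ}

/-- From the single-`K`-class binder `hK1` to the shape consumed by ★ (s4): every `g γ g⁻¹ ∈ K` is
`K`-conjugate to `γ`. [cite: Laumon1995, Lemma (5.3.2) p. 136] -/
theorem GLn.forall_exists_glInt_conj_eq_of_single_conjClass {γ : GL (Fin n) E}
    (hK1 : ∀ γ' ∈ glInt n E, IsConj γ γ' → ∃ k ∈ glInt n E, k * γ * k⁻¹ = γ') :
    ∀ g : GL (Fin n) E, g * γ * g⁻¹ ∈ glInt n E → ∃ k ∈ glInt n E, k * γ * k⁻¹ = g * γ * g⁻¹ :=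
  fun g hg => hK1 _ hg (isConj_iff.2 ⟨g, rfl⟩)

end Algebra

section CompactCore

variable {G : Type*} [Group G] [TopologicalSpace G] (C K : Subgroup G)

/-- **`C ∩ K ⊆ compactCore C` for `K` compact and `C` closed**: `C ∩ K` is (the carrier of) a
compact subgroup of `C`. Equality — «`C ∩ K` is THE maximal compact subgroup» — is the extra
arithmetic input `hcore` below. [cite: Rogawski1990, §4.3 p. 43] -/
theorem preimage_val_subset_compactCore (hC : IsClosed (C : Set G)) (hK : IsCompact (K : Set G)) :
    (Subtype.val ⁻¹' (K : Set G) : Set C) ⊆ compactCore C := by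
  have h : (Subtype.val ⁻¹' (K : Set G) : Set C) = ((K.subgroupOf C : Subgroup C) : Set C) := rfl
  rw [h]
  exact subset_compactCore_of_isCompact (hC.isClosedEmbedding_subtypeVal.isCompact_preimage hK)

end CompactCore

/-! ### The orbital reading on `GL_n(E)` -/

section Orbital

variable {E : Type*} [Field E] [ValuativeRel E] [TopologicalSpace E] [IsNonarchimedeanLocalField E]
  {n : ℕ} [MeasurableSpace (GL (Fin n) E)] [BorelSpace (GL (Fin n) E)]
  [SecondCountableTopology (GL (Fin n) E)] [T2Space (GL (Fin n) E)] [LocallyCompactSpace (GL (Fin n) E)]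
  (γ : GL (Fin n) E)
  [MeasurableSpace (GL (Fin n) E ⧸ Subgroup.centralizer ({γ} : Set (GL (Fin n) E)))]
  [BorelSpace (GL (Fin n) E ⧸ Subgroup.centralizer ({γ} : Set (GL (Fin n) E)))]
  [hC : IsClosed ((Subgroup.centralizer ({γ} : Set (GL (Fin n) E)) : Subgroup (GL (Fin n) E)) :
    Set (GL (Fin n) E))]
  (t : Measure ↥(Subgroup.centralizer ({γ} : Set (GL (Fin n) E)))) [t.IsMulLeftInvariant]
  [IsFiniteMeasureOnCompacts t] [t.IsOpenPosMeasure] [t.IsInvInvariant] [SFinite t]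
  (ν : Measure (GL (Fin n) E)) [IsHaarMeasure ν] [ν.IsMulRightInvariant]

/-- **(r2, `[0, ∞]`-valued) `∫⁻_{G ⧸ G_γ} 1_K(x γ x⁻¹) d(ν/t) = ν(K) ∕ t(G_γ ∩ K)`** for `γ ∈ K = GL_n(𝒪_E)`
under the single-`K`-class binder `hK1` (★ (s4) at `K = glInt n E`, compact open).
[cite: Laumon1995, Lemma (5.3.2) p. 136] -/
theorem GLn.lintegral_descConj_indicator_glInt_eq_of_single_conjClass (hγ : γ ∈ glInt n E)
    (hK1 : ∀ γ' ∈ glInt n E, IsConj γ γ' → ∃ k ∈ glInt n E, k * γ * k⁻¹ = γ') :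
    ∫⁻ x, descConj γ (Subgroup.centralizer ({γ} : Set (GL (Fin n) E)))
        (fun _ hg => Subgroup.mem_centralizer_singleton_iff.1 hg)
          (((glInt n E : Subgroup (GL (Fin n) E)) : Set (GL (Fin n) E)).indicator (1 : GL (Fin n) E → ℝ≥0∞)) x
          ∂quotientMeasure (Subgroup.centralizer ({γ} : Set (GL (Fin n) E))) t hC ν =
      ν (glInt n E : Set (GL (Fin n) E)) /
        t {c : ↥(Subgroup.centralizer ({γ} : Set (GL (Fin n) E))) | (c : GL (Fin n) E) ∈ glInt n E} :=
  lintegral_descConj_indicator_quotientMeasure_eq_of_single_conjClass γ (glInt n E) t ν (isOpen_glInt n E)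
    (isCompact_glInt n E) hγ (GLn.forall_exists_glInt_conj_eq_of_single_conjClass hK1)

/-- **(r2) `O_γ^{ν/t}(1_K) = (ν(K) ∕ t(G_γ ∩ K)).toReal`** — the orbital integral of the unit element
`1_K`, `K = GL_n(𝒪_E)`, at `γ ∈ K` whose `G`-class meets `K` in a SINGLE `K`-class (`hK1`): only the
class of `1` contributes in the fixed-point sum of ★ D-S3b. [cite: Laumon1995, Lemma (5.3.2) p. 136] [cite: Rogawski1990, §4.9 p. 54] -/
theorem GLn.orbitalIntegral_indicator_glInt_eq_of_single_conjClass (hγ : γ ∈ glInt n E)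
    (hK1 : ∀ γ' ∈ glInt n E, IsConj γ γ' → ∃ k ∈ glInt n E, k * γ * k⁻¹ = γ') :
    orbitalIntegral γ (((glInt n E : Subgroup (GL (Fin n) E)) : Set (GL (Fin n) E)).indicator
        (1 : GL (Fin n) E → ℝ)) (quotientMeasure (Subgroup.centralizer ({γ} : Set (GL (Fin n) E))) t hC ν) =
      (ν (glInt n E : Set (GL (Fin n) E)) /
        t {c : ↥(Subgroup.centralizer ({γ} : Set (GL (Fin n) E))) | (c : GL (Fin n) E) ∈ glInt n E}).toReal :=
  orbitalIntegral_indicator_quotientMeasure_eq_of_single_conjClass γ (glInt n E) t ν (isOpen_glInt n E)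
    (isCompact_glInt n E) hγ (GLn.forall_exists_glInt_conj_eq_of_single_conjClass hK1)

/-- **(r3) `O_γ^{ν/t}(1_K) = 1` at the normalisations `ν(K) = 1`, `t(G_γ ∩ K) = 1`** (`γ ∈ K`, single
`K`-class) — the unramified base value of the unit element (Kottwitz; Laumon (1996) Lemma (5.3.2)).
[cite: Laumon1995, Lemma (5.3.2) p. 136] [cite: Rogawski1990, §4.3 p. 43] -/
theorem GLn.orbitalIntegral_indicator_glInt_eq_one_of_single_conjClass (hγ : γ ∈ glInt n E)
    (hK1 : ∀ γ' ∈ glInt n E, IsConj γ γ' → ∃ k ∈ glInt n E, k * γ * k⁻¹ = γ')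
    (hν : ν (glInt n E : Set (GL (Fin n) E)) = 1)
    (ht : t {c : ↥(Subgroup.centralizer ({γ} : Set (GL (Fin n) E))) | (c : GL (Fin n) E) ∈ glInt n E} = 1) :
    orbitalIntegral γ (((glInt n E : Subgroup (GL (Fin n) E)) : Set (GL (Fin n) E)).indicator
        (1 : GL (Fin n) E → ℝ)) (quotientMeasure (Subgroup.centralizer ({γ} : Set (GL (Fin n) E))) t hC ν) = 1 :=
  orbitalIntegral_indicator_quotientMeasure_eq_one_of_single_conjClass γ (glInt n E) t ν (isOpen_glInt n E)
    (isCompact_glInt n E) hγ (GLn.forall_exists_glInt_conj_eq_of_single_conjClass hK1) hν ht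

/-- **(r3, canonical normalisation) `O_γ^{ν/t}(1_K) = ν(K).toReal`** when `t` is normalised on the
COMPACT CORE, `t(compactCore G_γ) = 1` (★ `OrbitalMeasureFamily.IsCanonical`'s convention), and
`G_γ ∩ K` IS the compact core (`hcore` — for residually separable `γ`, where `𝒪_E[γ]` is the maximal
order of `E[γ]`; one inclusion is `preimage_val_subset_compactCore`). [cite: Rogawski1990, §4.3 p. 43] -/
theorem GLn.orbitalIntegral_indicator_glInt_eq_of_single_conjClass_of_compactCore (hγ : γ ∈ glInt n E)
    (hK1 : ∀ γ' ∈ glInt n E, IsConj γ γ' → ∃ k ∈ glInt n E, k * γ * k⁻¹ = γ')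
    (hcore : {c : ↥(Subgroup.centralizer ({γ} : Set (GL (Fin n) E))) | (c : GL (Fin n) E) ∈ glInt n E} =
      compactCore ↥(Subgroup.centralizer ({γ} : Set (GL (Fin n) E))))
    (ht : t (compactCore ↥(Subgroup.centralizer ({γ} : Set (GL (Fin n) E)))) = 1) :
    orbitalIntegral γ (((glInt n E : Subgroup (GL (Fin n) E)) : Set (GL (Fin n) E)).indicator
        (1 : GL (Fin n) E → ℝ)) (quotientMeasure (Subgroup.centralizer ({γ} : Set (GL (Fin n) E))) t hC ν) =
      (ν (glInt n E : Set (GL (Fin n) E))).toReal := by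
  rw [GLn.orbitalIntegral_indicator_glInt_eq_of_single_conjClass γ t ν hγ hK1, hcore, ht, div_one]

end Orbital

/-! ### Docking to canonical orbital measure families -/

section Canonical

variable {E : Type*} [Field E] [ValuativeRel E] [TopologicalSpace E] [IsNonarchimedeanLocalField E]
  {n : ℕ} [MeasurableSpace (GL (Fin n) E)] [BorelSpace (GL (Fin n) E)]
  [SecondCountableTopology (GL (Fin n) E)] [T2Space (GL (Fin n) E)] [LocallyCompactSpace (GL (Fin n) E)]
  [∀ γ : GL (Fin n) E, MeasurableSpace (GL (Fin n) E ⧸ Subgroup.centralizer ({γ} : Set (GL (Fin n) E)))]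
  [∀ γ : GL (Fin n) E, BorelSpace (GL (Fin n) E ⧸ Subgroup.centralizer ({γ} : Set (GL (Fin n) E)))]
  (ν : Measure (GL (Fin n) E)) [IsHaarMeasure ν] [ν.IsMulRightInvariant]

/-- **The unit element against a CANONICAL orbital measure family**: if `m` is canonical for
`(P, ν)` (★ `OrbitalMeasureFamily.IsCanonical`: at every `P`-class, `m c = ν ∕ t_c` with `t_c` the
inversion-invariant Haar measure on `G_{γ_c}` of mass one on the compact core) then at every `P`-class
`c` whose representative `γ_c` lies in `K = GL_n(𝒪_E)`, has a single `K`-class in `(G·γ_c) ∩ K` (`hK1`)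
and `G_{γ_c} ∩ K = compactCore G_{γ_c}` (`hcore`):
**`classOrbitalIntegral m 1_K c = ν(K).toReal`** (`= 1` at `vol K = 1`) — the unramified base value
of the unit element (Kottwitz; Laumon (1996), Lemma (5.3.2); Rogawski §4.9).
[cite: Laumon1995, Lemma (5.3.2) p. 136] [cite: Rogawski1990, §4.3 p. 43] -/
theorem GLn.classOrbitalIntegral_indicator_glInt_eq_of_isCanonical {P : GL (Fin n) E → Prop}
    {m : OrbitalMeasureFamily (GL (Fin n) E)} (hm : m.IsCanonical P ν) (c : ConjClasses (GL (Fin n) E))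
    (hPc : P (Quotient.out c)) (hγ : (Quotient.out c : GL (Fin n) E) ∈ glInt n E)
    (hK1 : ∀ γ' ∈ glInt n E, IsConj (Quotient.out c : GL (Fin n) E) γ' →
      ∃ k ∈ glInt n E, k * (Quotient.out c : GL (Fin n) E) * k⁻¹ = γ')
    (hcore : {z : ↥(Subgroup.centralizer ({(Quotient.out c : GL (Fin n) E)} : Set (GL (Fin n) E))) |
        (z : GL (Fin n) E) ∈ glInt n E} =
      compactCore ↥(Subgroup.centralizer ({(Quotient.out c : GL (Fin n) E)} : Set (GL (Fin n) E)))) :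
    classOrbitalIntegral m (((glInt n E : Subgroup (GL (Fin n) E)) : Set (GL (Fin n) E)).indicator
        (1 : GL (Fin n) E → ℝ)) c = (ν (glInt n E : Set (GL (Fin n) E))).toReal := by
  obtain ⟨t, ht, hti, htc, hmc⟩ := hm c hPc
  haveI : IsClosed ((Subgroup.centralizer ({(Quotient.out c : GL (Fin n) E)} : Set (GL (Fin n) E)) :
      Subgroup (GL (Fin n) E)) : Set (GL (Fin n) E)) := isClosed_coe_centralizer_singleton _
  haveI : BorelSpace ↥(Subgroup.centralizer ({(Quotient.out c : GL (Fin n) E)} : Set (GL (Fin n) E))) :=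
    Subtype.borelSpace _
  haveI : SecondCountableTopology
      ↥(Subgroup.centralizer ({(Quotient.out c : GL (Fin n) E)} : Set (GL (Fin n) E))) :=
    TopologicalSpace.Subtype.secondCountableTopology _
  rw [classOrbitalIntegral_eq, hmc]
  exact GLn.orbitalIntegral_indicator_glInt_eq_of_single_conjClass_of_compactCore _ t ν hγ hK1 hcore htc

/-- **`classOrbitalIntegral m 1_K c = 1`** for a canonical family at `vol(K) = 1` (same hypotheses).
[cite: Laumon1995, Lemma (5.3.2) p. 136] [cite: Rogawski1990, §4.3 p. 43] -/
theorem GLn.classOrbitalIntegral_indicator_glInt_eq_one_of_isCanonical {P : GL (Fin n) E → Prop}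
    {m : OrbitalMeasureFamily (GL (Fin n) E)} (hm : m.IsCanonical P ν) (c : ConjClasses (GL (Fin n) E))
    (hPc : P (Quotient.out c)) (hγ : (Quotient.out c : GL (Fin n) E) ∈ glInt n E)
    (hK1 : ∀ γ' ∈ glInt n E, IsConj (Quotient.out c : GL (Fin n) E) γ' →
      ∃ k ∈ glInt n E, k * (Quotient.out c : GL (Fin n) E) * k⁻¹ = γ')
    (hcore : {z : ↥(Subgroup.centralizer ({(Quotient.out c : GL (Fin n) E)} : Set (GL (Fin n) E))) |
        (z : GL (Fin n) E) ∈ glInt n E} =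
      compactCore ↥(Subgroup.centralizer ({(Quotient.out c : GL (Fin n) E)} : Set (GL (Fin n) E))))
    (hν : ν (glInt n E : Set (GL (Fin n) E)) = 1) :
    classOrbitalIntegral m (((glInt n E : Subgroup (GL (Fin n) E)) : Set (GL (Fin n) E)).indicator
        (1 : GL (Fin n) E → ℝ)) c = 1 := by
  rw [GLn.classOrbitalIntegral_indicator_glInt_eq_of_isCanonical ν hm c hPc hγ hK1 hcore, hν, ENNReal.toReal_one]

end Canonical

end Literature.NumberTheory.Automorphic
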